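import Literature.Topology.FourManifolds.WrinkledFibrationMoveModels
import HarnessLib

/-!
# Lekili's birth move: the critical circle and the two cusps of the new-born wrinkle

Topic `Literature/Topology/FourManifolds`.  The birth family
`F_s(t, x, y, z) = (t, x³ + 3(t² - s) x + y² - z²)` (`birthMap s`,
`WrinkledFibrationMoveModels.lean`; Eliashberg–Mishachev's wrinkle) has, for `s > 0`, the
critical CIRCLE `{t² + x² = s, y = z = 0}` (Lekili 2009, §3, Move 1: *"For `s>0`, the critical
point set of `F_s` is the circle `{x²+t²=s, y=z=0}`, whereas the critical value set `C_s` is a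
wrinkle shown on the left of Figure 3"* — an eye with two cusps).  Parametrising the circle by
the angle, `θ ↦ (√s cos θ, √s sin θ, 0, 0)`, the critical image is the plane curve
`θ ↦ (√s cos θ, -2 s√s sin³ θ)` and its velocity `(-√s sin θ, -6 s√s sin² θ cos θ)` vanishes
exactly when `sin θ = 0`: the wrinkle has exactly two cusps, at `(t, x) = (±√s, 0)`.
Everything is PROVED at the level of the model map; no named fact.

* `birthCircle s θ`, `not_surjective_fderiv_birthMap_birthCircle`,
  `exists_birthCircle_of_not_surjective` — the angle parametrisation IS the critical set;
* `birthMap_birthCircle` — the critical image `(√s cos θ, -2 s√s sin³ θ)`;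
* `hasDerivAt_birth_image`, `birth_image_deriv_eq_zero_iff` (`↔ sin θ = 0`),
  `birthCircle_eq_of_sin_eq_zero` (the two cusp points `(±√s, 0, 0, 0)`).

## References

* Y. Lekili, *Wrinkled fibrations on near-symplectic manifolds*, Geom. Topol. 13 (2009)
  277–318 (arXiv:0712.2202), §3, Move 1. [Lekili2009]
* R. İ. Baykur, O. Saeki, *Simplifying indefinite fibrations on 4-manifolds*, arXiv:1705.11169,
  §3.1 (birth). [BaykurSaeki2017]
-/

noncomputable section

open scoped ContDiff
open Set Function

namespace Literature.Topology.FourManifolds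

/-- Local notation: `𝔼 n` is the model Euclidean space `EuclideanSpace ℝ (Fin n)`. -/
local notation "𝔼 " n:arg => EuclideanSpace ℝ (Fin n)

/-! ### The critical circle, parametrised by the angle -/

/-- The angle parametrisation `θ ↦ (√s cos θ, √s sin θ, 0, 0)` of the critical circle of the
birth family (`s > 0`). [folklore] -/
def birthCircle (s θ : ℝ) : 𝔼 4 :=
  WithLp.toLp 2 ![Real.sqrt s * Real.cos θ, Real.sqrt s * Real.sin θ, 0, 0]

/-- Coordinates of `birthCircle`: `t = √s cos θ`. [folklore] -/
@[simp] theorem birthCircle_apply_zero (s θ : ℝ) :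
    birthCircle s θ 0 = Real.sqrt s * Real.cos θ := by
  simp [birthCircle]

/-- Coordinates of `birthCircle`: `x = √s sin θ`. [folklore] -/
@[simp] theorem birthCircle_apply_one (s θ : ℝ) :
    birthCircle s θ 1 = Real.sqrt s * Real.sin θ := by
  simp [birthCircle]

/-- Coordinates of `birthCircle`: `y = 0`. [folklore] -/
@[simp] theorem birthCircle_apply_two (s θ : ℝ) : birthCircle s θ 2 = 0 := by
  simp [birthCircle]

/-- Coordinates of `birthCircle`: `z = 0`. [folklore] -/
@[simp] theorem birthCircle_apply_three (s θ : ℝ) : birthCircle s θ 3 = 0 := by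
  simp [birthCircle]

/-- `t² + x² = s` on the circle. [folklore] -/
theorem birthCircle_sq_add_sq {s : ℝ} (hs : 0 ≤ s) (θ : ℝ) :
    birthCircle s θ 0 ^ 2 + birthCircle s θ 1 ^ 2 = s := by
  simp only [birthCircle_apply_zero, birthCircle_apply_one, mul_pow, Real.sq_sqrt hs]
  linear_combination s * Real.cos_sq_add_sin_sq θ

/-- **Every point of the angle parametrisation is critical** for the birth family.
[cite: Lekili2009, §3 Move 1] -/
theorem not_surjective_fderiv_birthMap_birthCircle {s : ℝ} (hs : 0 ≤ s) (θ : ℝ) :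
    ¬ Surjective (fderiv ℝ (birthMap s) (birthCircle s θ)) := by
  rw [surjective_fderiv_birthMap_iff, not_not]
  exact ⟨birthCircle_sq_add_sq hs θ, by simp, by simp⟩

/-- **The angle parametrisation exhausts the critical circle**: for `s > 0` every critical
point of the birth family is `(√s cos θ, √s sin θ, 0, 0)` for some `θ` (write
`(t + i x)/√s = e^{iθ}` on the unit circle). [cite: Lekili2009, §3 Move 1] -/
theorem exists_birthCircle_of_not_surjective {s : ℝ} (hs : 0 < s) {x : 𝔼 4}
    (hx : ¬ Surjective (fderiv ℝ (birthMap s) x)) : ∃ θ, x = birthCircle s θ := by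
  rw [surjective_fderiv_birthMap_iff, not_not] at hx
  obtain ⟨h01, h2, h3⟩ := hx
  have hr : 0 < Real.sqrt s := Real.sqrt_pos.mpr hs
  have hr2 : Real.sqrt s ^ 2 = s := Real.sq_sqrt hs.le
  set z : ℂ := ⟨x 0 / Real.sqrt s, x 1 / Real.sqrt s⟩ with hz_def
  have hz2 : ‖z‖ ^ 2 = 1 := by
    rw [Complex.sq_norm, Complex.normSq_apply]
    simp only [hz_def]
    field_simp
    nlinarith [h01, hr2]
  have hz1 : ‖z‖ = 1 := (pow_eq_one_iff_of_nonneg (norm_nonneg z) two_ne_zero).mp hz2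
  obtain ⟨θ, hθ⟩ := (Complex.norm_eq_one_iff z).mp hz1
  refine ⟨θ, ?_⟩
  have hre : Real.cos θ = x 0 / Real.sqrt s := by
    rw [← Complex.exp_ofReal_mul_I_re θ, hθ]
  have him : Real.sin θ = x 1 / Real.sqrt s := by
    rw [← Complex.exp_ofReal_mul_I_im θ, hθ]
  ext i
  fin_cases i
  · simp [hre, mul_div_cancel₀ _ hr.ne']
  · simp [him, mul_div_cancel₀ _ hr.ne']
  · simpa using h2
  · simpa using h3

/-! ### The critical image and its two cusps -/

/-- **The critical image of the birth family**: `F_s(√s cos θ, √s sin θ, 0, 0) =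
(√s cos θ, -2 s√s sin³ θ)` (on the circle `t² - s = -s sin² θ`, so
`x³ + 3(t² - s) x = -2 x³`). [folklore] -/
theorem birthMap_birthCircle {s : ℝ} (hs : 0 ≤ s) (θ : ℝ) :
    birthMap s (birthCircle s θ) =
      (Real.sqrt s * Real.cos θ) • EuclideanSpace.single (0 : Fin 2) (1 : ℝ) +
        (-(2 * s * Real.sqrt s * Real.sin θ ^ 3)) • EuclideanSpace.single (1 : Fin 2) (1 : ℝ) := by
  have hr2 : Real.sqrt s ^ 2 = s := Real.sq_sqrt hs
  have hcs : Real.cos θ ^ 2 = 1 - Real.sin θ ^ 2 := Real.cos_sq' θ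
  ext i
  fin_cases i
  · simp [birthMap]
  · simp [birthMap]
    linear_combination (3 * Real.sqrt s * Real.sin θ - 2 * Real.sqrt s * Real.sin θ ^ 3) * hr2 +
      3 * Real.sqrt s ^ 3 * Real.sin θ * hcs

/-- **Velocity of the critical image of the birth family**:
`(-√s sin θ, -6 s√s sin² θ cos θ)`. [folklore] -/
theorem hasDerivAt_birth_image {s : ℝ} (hs : 0 ≤ s) (θ : ℝ) :
    HasDerivAt (fun θ => birthMap s (birthCircle s θ))
      ((-(Real.sqrt s * Real.sin θ)) • EuclideanSpace.single (0 : Fin 2) (1 : ℝ) +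
        (-(6 * s * Real.sqrt s * Real.sin θ ^ 2 * Real.cos θ)) •
          EuclideanSpace.single (1 : Fin 2) (1 : ℝ)) θ := by
  have hc : HasDerivAt (fun θ => Real.sqrt s * Real.cos θ) (Real.sqrt s * -Real.sin θ) θ :=
    (Real.hasDerivAt_cos θ).const_mul _
  have hs3 : HasDerivAt (fun θ => Real.sin θ ^ 3) (3 * Real.sin θ ^ 2 * Real.cos θ) θ :=
    ((Real.hasDerivAt_sin θ).pow 3).congr_deriv (by norm_num)
  have h2 : HasDerivAt (fun θ => -(2 * s * Real.sqrt s * Real.sin θ ^ 3))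
      (-(2 * s * Real.sqrt s * (3 * Real.sin θ ^ 2 * Real.cos θ))) θ :=
    (hs3.const_mul (2 * s * Real.sqrt s)).neg
  have h := (hc.smul_const (EuclideanSpace.single (0 : Fin 2) (1 : ℝ))).add
    (h2.smul_const (EuclideanSpace.single (1 : Fin 2) (1 : ℝ)))
  have hfun : (fun θ => birthMap s (birthCircle s θ)) = fun θ =>
      (Real.sqrt s * Real.cos θ) • EuclideanSpace.single (0 : Fin 2) (1 : ℝ) +
        (-(2 * s * Real.sqrt s * Real.sin θ ^ 3)) • EuclideanSpace.single (1 : Fin 2) (1 : ℝ) :=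
    funext (birthMap_birthCircle hs)
  rw [hfun]
  refine h.congr_deriv ?_
  congr 1
  · congr 1
    ring
  · congr 1
    ring

/-- **The wrinkle has its cusps exactly where `sin θ = 0`**: for `s > 0` the velocity of the
critical image vanishes iff `sin θ = 0` (first component `-√s sin θ`), i.e. at the two points
`θ ≡ 0, π` of the circle — *"a wrinkle"* with two cusps (Lekili 2009, §3, Move 1, Fig. 3).
[cite: Lekili2009, §3 Move 1] -/
theorem birth_image_deriv_eq_zero_iff {s : ℝ} (hs : 0 < s) (θ : ℝ) :
    deriv (fun θ => birthMap s (birthCircle s θ)) θ = 0 ↔ Real.sin θ = 0 := by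
  rw [(hasDerivAt_birth_image hs.le θ).deriv]
  have hr : 0 < Real.sqrt s := Real.sqrt_pos.mpr hs
  constructor
  · intro h
    have h0 := congrArg (fun w : 𝔼 2 => w 0) h
    simp only [PiLp.add_apply, PiLp.smul_apply, smul_eq_mul, PiLp.zero_apply] at h0
    simp at h0
    rcases h0 with h0 | h0
    · exact absurd h0 hr.ne'
    · exact h0
  · intro h
    simp [h]

/-- **The two cusp points**: where `sin θ = 0` the point of the critical circle is
`(√s, 0, 0, 0)` or `(-√s, 0, 0, 0)`. [folklore] -/
theorem birthCircle_eq_of_sin_eq_zero {s θ : ℝ} (h : Real.sin θ = 0) :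
    birthCircle s θ = WithLp.toLp 2 ![Real.sqrt s, 0, 0, 0] ∨
      birthCircle s θ = WithLp.toLp 2 ![-Real.sqrt s, 0, 0, 0] := by
  rcases Real.sin_eq_zero_iff_cos_eq.mp h with hc | hc
  · left
    ext i
    fin_cases i <;> simp [h, hc]
  · right
    ext i
    fin_cases i <;> simp [h, hc]

end Literature.Topology.FourManifolds

end
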